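import Literature.NumberTheory.NumberFields.GassmannPermChar
import Literature.RepresentationTheory.FiniteGroups.WeaklyIsomorphicPermutationRepresentations
import Literature.RepresentationTheory.FiniteGroups.PermutationCharacter
import HarnessLib

/-!
# Gassmann equivalent `G`-sets and Gassmann triples through permutation modules: `k[X] ≅ k[Y]` iff every
# `g` has as many fixed points on `X` as on `Y` (any field of characteristic `0`), and `(G, H, H′)` is a
# Gassmann triple iff `k[G/H] ≅ k[G/H′]` (Lin–Shinder–Zimmermann, Lemma 2.3; Perlis; Serre Ex. 13.5)

Topic `Literature/RepresentationTheory/FiniteGroups`, namespace `Literature.RepresentationTheory.FiniteGroups`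
(lane `lit-hodgefound`, prover p38, generation 30, row g30-#3; the bridge announced as successor pointer σ3 of
generation 29 between the tree's GROUP-THEORETIC Gassmann equivalence `Literature.NumberTheory.NumberFields.
IsGassmannEquivalent H H′` (`NumberTheory/NumberFields/ArithmeticEquivalence`, Perlis: `|c ∩ H| = |c ∩ H′|` for
every conjugacy class `c`; `GassmannPermChar`: `IsGassmannEquivalent.card_fixedBy_quotient_eq`, the counting lemmas
`Gassmann.card_fixedBy_quotient_mul_card`, `Gassmann.card_inv_conj_mem_eq`) and the MODULE-THEORETIC statements of
`WeaklyIsomorphicPermutationRepresentations` (g29-#9, Serre Ex. 13.5 over `ℚ`) / `EquivOfCharacter`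
(`Representation.nonempty_equiv_of_character_eq`, any field of characteristic `0`)).  Everything here is
**proved**; no definition, no named fact, no instance.

Sources, verbatim.  H.-Y. Lin, E. Shinder, S. Zimmermann, *Factorization centers in dimension 2 and the
Grothendieck ring of varieties*, Algebraic Geometry 10 (2023) 666–693 (held `paper:doi-10-14231-ag-2023-024`,
p0005–p0006), §2.1: "**Lemma-Definition 2.1.** Let `G` be a profinite group, and let `A`, `B` be continuous
finite `G`-sets. Fix a field `F` of characteristic zero. The following conditions are equivalent: (1) We have
`μ_G(A) = μ_G(B)` in `K_0(Rep(G, F))`. (2) We have `F[A] ≃ F[B]` as `F[G]`-modules. We say that two continuous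
finite `G`-sets `A` and `B` are Gassmann equivalent if they satisfy one of the above equivalent conditions. […]
**Lemma 2.3** ([Par13, Proposition 1], cf. [Pra17, Definition 1]). Let `G` be a finite group, and let `A` and
`B` be finite `G`-sets. Fix a field `F` of characteristic zero. The following conditions are equivalent: (1)
Every `g ∈ G` fixes the same number of elements in `A` and in `B`. (2) There exist subgroups `H_1, …, H_r`,
`H′_1, …, H′_r` of `G` such that `A ≃ ⊔ G/H_i`, `B ≃ ⊔ G/H′_i` and for each conjugacy class `T ⊂ G` these
subgroups satisfy `Σ_i |T ∩ H_i|/|H_i| = Σ_i |T ∩ H′_i|/|H′_i|` (2.2). (3) `A` and `B` are Gassmann equivalent.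
In particular, the kernel of `μ` is independent of the choice of `F`. […] **Remark 2.4.** The number of
`G`-orbits in Gassmann-equivalent continuous `G`-sets is the same. […] Then `G/H` and `G/H′` are Gassmann
equivalent; in this case one refers to `(G, H, H′)` as a Gassmann triple. It is well known and easy to see (for
example using (2.2) with `r = 1`) that if `H` is normal, then `H′ = H`."  R. Perlis, *On the equation
`ζ_K(s) = ζ_{K′}(s)`*, J. Number Theory 9 (1977), §1 (held `paper:doi-10-1016-0022-314x-77-90070-1`, p0003):
"Two subgroups `H`, `H′` of a finite group `G` are said to be Gassmann equivalent in `G` when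
`|c^G ∩ H| = |c^G ∩ H′|` for every conjugacy class `c^G = {g·c·g⁻¹ | g ∈ G}` in `G`.  LEMMA 1 (Gassmann). Two
subgroups `H` and `H′` of a finite group `G` are Gassmann equivalent if and only if the coset types of
`G mod (H, C)` and `G mod (H′, C)` coincide for every cyclic subgroup `C` of `G`."  J.-P. Serre, *Linear
Representations of Finite Groups* §13.1 Exercise 13.5 (the four equivalent conditions (i)–(iv) for `ρ_X ≅ ρ_Y`,
formalised in `WeaklyIsomorphicPermutationRepresentations`).

## What is proved

* §1 (finite `Γ`-sets `X`, `Y`; `k` a field of characteristic `0`)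
  **`nonempty_equiv_ofMulAction_iff_forall_natCard_fixedBy_eq_field`** (Lemma 2.3 (1)⟺(3): `k[X] ≅ k[Y]` iff
  `Card(X^g) = Card(Y^g)` for all `g`), `nonempty_equiv_ofMulAction_iff_rat` (independence of `k`),
  `natCard_orbitRel_quotient_eq_of_nonempty_equiv_ofMulAction` (Remark 2.4: same number of orbits).
* §2 (subgroups `H`, `H′` of a finite group `G`) **`isGassmannEquivalent_iff_forall_natCard_fixedBy_quotient_eq`**
  (Gassmann ⟺ the same permutation character: the converse of the tree's `IsGassmannEquivalent.card_fixedBy_quotient_eq`,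
  (2.2) with `r = 1`), **`isGassmannEquivalent_iff_nonempty_equiv_ofMulAction_quotient`** (Gassmann triple ⟺
  `k[G/H] ≅ k[G/H′]` for one/every field `k` of characteristic `0`),
  `isGassmannEquivalent_iff_forall_natCard_orbitRel_quotient_eq` (⟺ `|K\G/H| = |K\G/H′|` for all `K ≤ G`),
  `isGassmannEquivalent_iff_forall_natCard_orbitRel_quotient_zpowers_eq` (⟺ the same for the cyclic `K`).
  The character form `1_{H}^G = 1_{H′}^G ⟺ Gassmann` already stands as
  `Literature.AlgebraicGeometry.Motives.AbelianVariety.indClassFun_one_eq_iff_gassmann`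
  (`Motives/AbelianVarietyInducedBrauerRelations`) and is not restated.

## Mathlib / tree search

Mathlib: `MulAction.fixedBy`, `orbitRel.Quotient`, `Quotient.congrRight`, `Subgroup.card_mul_index`,
`Representation.ofMulAction`, `Representation.char_iso`.  Tree (`lean search Gassmann --decl`): `IsGassmannEquivalent`
(+ `refl/symm/trans/card_eq`, `card_fixedBy_quotient_eq`, `exists_eq_map_conj` for index `≤ 6`, `eq_of_normal`),
`isGassmannEquivalent_iff_card_conj`, the Motives series (`…_of_gassmann` isogenies, `indClassFun_one_eq_iff_gassmann`);
no statement linking `IsGassmannEquivalent` to the permutation MODULES `k[G/H]` before this file.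

## References

* [LinShinderZimmermann2023] H.-Y. Lin, E. Shinder, S. Zimmermann, *Factorization centers in dimension 2 and the
  Grothendieck ring of varieties*, Algebr. Geom. 10 (6) (2023) 666–693, §2.1: Lemma-Definition 2.1, Lemma 2.3,
  Remark 2.4, Prop. 2.5 (proof).
* [Perlis1977] R. Perlis, *On the equation `ζ_K(s) = ζ_{K′}(s)`*, J. Number Theory 9 (1977) 342–360, §1, Lemma 1.
* [Buser2010] P. Buser, *Geometry and Spectra of Compact Riemann Surfaces*, Birkhäuser 2010, Def. 11.1.1, Lemma 11.2.4.
* [SerreLinearRepresentations1977] J.-P. Serre, *Linear Representations of Finite Groups*, GTM 42, §13.1 Ex. 13.5.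
-/

noncomputable section

open Module Representation MulAction
open Literature.NumberTheory.NumberFields

namespace Literature.RepresentationTheory.FiniteGroups

/-! ## §1 Gassmann equivalent `G`-sets over a field of characteristic `0` -/

section GSets

variable {k : Type*} [Field k] [CharZero k] {Γ : Type} [Group Γ] [Fintype Γ] {X Y : Type} [Fintype X]
  [MulAction Γ X] [Fintype Y] [MulAction Γ Y]

/-- **Lin–Shinder–Zimmermann Lemma 2.3, (1) ⟺ (3) (Parzanchevski): for a finite group `Γ`, finite
`Γ`-sets `X`, `Y` and a field `k` of characteristic `0`, `k[X] ≅ k[Y]` as `k[Γ]`-modules iff every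
`g ∈ Γ` fixes the same number of elements in `X` and in `Y`** (the characters of the permutation modules
are `g ↦ Card(X^g)`, and in characteristic `0` the character determines the representation).
[cite: LinShinderZimmermann2023, Lemma-Definition 2.1 and Lemma 2.3 (1)⟺(3)]
[cite: SerreLinearRepresentations1977, §13.1 Exercise 13.5 (i)⟺(ii) (p0091)] -/
theorem nonempty_equiv_ofMulAction_iff_forall_natCard_fixedBy_eq_field (k : Type*) [Field k] [CharZero k] :
    Nonempty ((Representation.ofMulAction k Γ X).Equiv (Representation.ofMulAction k Γ Y)) ↔
      ∀ g : Γ, Nat.card (fixedBy X g) = Nat.card (fixedBy Y g) := by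
  constructor
  · rintro ⟨e⟩ g
    have h := congrFun (Representation.char_iso e) g
    rw [character_ofMulAction_eq_natCard_fixedBy_field, character_ofMulAction_eq_natCard_fixedBy_field] at h
    exact_mod_cast h
  · intro h
    refine Representation.nonempty_equiv_of_character_eq _ _ (funext fun g => ?_)
    rw [character_ofMulAction_eq_natCard_fixedBy_field, character_ofMulAction_eq_natCard_fixedBy_field, h g]

/-- **Gassmann equivalence of `G`-sets does not depend on the field** ("condition (3) is independent of
the choice of `F`"): `k[X] ≅ k[Y]` over one field `k` of characteristic `0` iff `ℚ[X] ≅ ℚ[Y]`.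
[cite: LinShinderZimmermann2023, Lemma 2.3 ("In particular, the kernel of `μ` is independent of the choice
of `F`")] -/
theorem nonempty_equiv_ofMulAction_iff_rat (k : Type*) [Field k] [CharZero k] :
    Nonempty ((Representation.ofMulAction k Γ X).Equiv (Representation.ofMulAction k Γ Y)) ↔
      Nonempty ((Representation.ofMulAction ℚ Γ X).Equiv (Representation.ofMulAction ℚ Γ Y)) := by
  rw [nonempty_equiv_ofMulAction_iff_forall_natCard_fixedBy_eq_field k,
    nonempty_equiv_ofMulAction_iff_forall_natCard_fixedBy_eq]

/-- **Lin–Shinder–Zimmermann Remark 2.4: Gassmann-equivalent `G`-sets have the same number of orbits** (the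
number of orbits is the multiplicity of the trivial representation in the permutation representation).
[cite: LinShinderZimmermann2023, Remark 2.4] -/
theorem natCard_orbitRel_quotient_eq_of_nonempty_equiv_ofMulAction (k : Type*) [Field k] [CharZero k]
    (h : Nonempty ((Representation.ofMulAction k Γ X).Equiv (Representation.ofMulAction k Γ Y))) :
    Nat.card (orbitRel.Quotient Γ X) = Nat.card (orbitRel.Quotient Γ Y) := by
  rw [nonempty_equiv_ofMulAction_iff_rat k, nonempty_equiv_ofMulAction_iff_forall_natCard_orbitRel_quotient_eq] at h
  have e : ∀ (Z : Type) [MulAction Γ Z],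
      orbitRel.Quotient (⊤ : Subgroup Γ) Z ≃ orbitRel.Quotient Γ Z := fun Z _ =>
    Quotient.congrRight fun a b => by
      rw [orbitRel_apply, orbitRel_apply, mem_orbit_iff, mem_orbit_iff]
      exact ⟨fun ⟨g, hg⟩ => ⟨(g : Γ), hg⟩, fun ⟨g, hg⟩ => ⟨⟨g, Subgroup.mem_top g⟩, hg⟩⟩
  rw [← Nat.card_congr (e X), ← Nat.card_congr (e Y)]
  exact h ⊤

end GSets

/-! ## §2 Gassmann triples `(G, H, H′)`: `|c ∩ H| = |c ∩ H′|` for all classes `c` ⟺ `k[G/H] ≅ k[G/H′]` -/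

section Triples

variable {G : Type} [Group G] [Fintype G]

/-- **Gassmann equivalence is having the same permutation character** ((2.2) of Lin–Shinder–Zimmermann with
`r = 1`: `|T ∩ H|/|H| = |T ∩ H′|/|H′|` for every conjugacy class `T`; Buser's "almost conjugate iff
`χ_{H_1} = χ_{H_2}`"): `H`, `H′` are Gassmann equivalent in the finite group `G` iff every `g ∈ G` fixes as many
points of `G/H` as of `G/H′` (both numbers are `|C_G(g)| · |g^G ∩ H| / |H|`, and at `g = 1` the condition gives
`|H| = |H′|`). [cite: LinShinderZimmermann2023, Lemma 2.3 (2) and (2.2) with `r = 1` (proof of Prop. 2.5: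
"Then `G/H` and `G/H′` are Gassmann equivalent; … `(G, H, H′)` … a Gassmann triple")] [cite: Perlis1977, §1
Lemma 1] [cite: Buser2010, Lemma 11.2.4] -/
theorem isGassmannEquivalent_iff_forall_natCard_fixedBy_quotient_eq (H H' : Subgroup G) :
    IsGassmannEquivalent H H' ↔
      ∀ g : G, Nat.card (fixedBy (G ⧸ H) g) = Nat.card (fixedBy (G ⧸ H') g) := by
  refine ⟨fun h g => h.card_fixedBy_quotient_eq g, fun h x => ?_⟩
  -- `|H| = |H'|` from `g = 1`
  have h1 := h 1
  rw [natCard_fixedBy_one, natCard_fixedBy_one] at h1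
  have hcard : Nat.card H = Nat.card H' := by
    have e1 := Subgroup.card_mul_index H
    have e2 := Subgroup.card_mul_index H'
    rw [Subgroup.index, h1, ← Subgroup.index] at e1
    exact Nat.eq_of_mul_eq_mul_right (Nat.pos_of_ne_zero Subgroup.index_ne_zero_of_finite) (e1.trans e2.symm)
  -- `|Fix_{G/H}(x)| · |H| = |C_G(x)| · |x^G ∩ H|`
  have hx1 := Gassmann.card_fixedBy_quotient_mul_card H x
  have hx2 := Gassmann.card_fixedBy_quotient_mul_card H' x
  rw [Gassmann.card_inv_conj_mem_eq] at hx1 hx2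
  rw [h x, hcard, hx2] at hx1
  exact (Nat.eq_of_mul_eq_mul_left Nat.card_pos hx1).symm

/-- **`(G, H, H′)` is a Gassmann triple iff `k[G/H] ≅ k[G/H′]` as `k[G]`-modules** for one/every field `k` of
characteristic `0` (Lin–Shinder–Zimmermann: "`G/H` and `G/H′` are Gassmann equivalent", Gassmann equivalence of
`G`-sets being `F[A] ≃ F[B]`). [cite: LinShinderZimmermann2023, Lemma-Definition 2.1, Lemma 2.3 and proof of
Prop. 2.5 ("Gassmann triple")] [cite: Perlis1977, §1 (definition) and Lemma 1] -/
theorem isGassmannEquivalent_iff_nonempty_equiv_ofMulAction_quotient (k : Type*) [Field k] [CharZero k]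
    (H H' : Subgroup G) :
    IsGassmannEquivalent H H' ↔
      Nonempty ((Representation.ofMulAction k G (G ⧸ H)).Equiv (Representation.ofMulAction k G (G ⧸ H'))) := by
  classical
  rw [nonempty_equiv_ofMulAction_iff_forall_natCard_fixedBy_eq_field k,
    isGassmannEquivalent_iff_forall_natCard_fixedBy_quotient_eq]

/-- … iff for every subgroup `K ≤ G` the numbers of `K`-orbits on `G/H` and on `G/H′` agree, i.e. the numbers
of double cosets `|K\G/H| = |K\G/H′|` (Serre's Exercise 13.5 (iii); Perlis's Lemma 1 compares, more finely,
the coset TYPES of `G mod (H, C)` and `G mod (H′, C)` for cyclic `C`). [cite: SerreLinearRepresentations1977,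
§13.1 Exercise 13.5 (i)⟺(iii) (p0091)] [cite: Perlis1977, §1 Lemma 1] [cite: LinShinderZimmermann2023, Remark 2.4] -/
theorem isGassmannEquivalent_iff_forall_natCard_orbitRel_quotient_eq (H H' : Subgroup G) :
    IsGassmannEquivalent H H' ↔
      ∀ K : Subgroup G, Nat.card (orbitRel.Quotient K (G ⧸ H)) = Nat.card (orbitRel.Quotient K (G ⧸ H')) := by
  classical
  rw [isGassmannEquivalent_iff_forall_natCard_fixedBy_quotient_eq,
    forall_natCard_fixedBy_eq_iff_forall_natCard_orbitRel_quotient_eq]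
  exact Iff.rfl

/-- … and it suffices to compare the orbit counts of the CYCLIC subgroups (Exercise 13.5 (iv)).
[cite: SerreLinearRepresentations1977, §13.1 Exercise 13.5 (i)⟺(iv) (p0091)] [cite: Perlis1977, §1 Lemma 1
("for every cyclic subgroup `C` of `G`")] -/
theorem isGassmannEquivalent_iff_forall_natCard_orbitRel_quotient_zpowers_eq (H H' : Subgroup G) :
    IsGassmannEquivalent H H' ↔
      ∀ g : G, Nat.card (orbitRel.Quotient (Subgroup.zpowers g) (G ⧸ H)) =
        Nat.card (orbitRel.Quotient (Subgroup.zpowers g) (G ⧸ H')) := by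
  classical
  rw [isGassmannEquivalent_iff_nonempty_equiv_ofMulAction_quotient ℚ,
    nonempty_equiv_ofMulAction_iff_forall_natCard_orbitRel_quotient_zpowers_eq]
  exact Iff.rfl

end Triples

end Literature.RepresentationTheory.FiniteGroups

end
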